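import Literature.NumberTheory.Transcendental.NesterenkoUResultant
import Mathlib.RingTheory.Valuation.LocalSubring
import Mathlib.RingTheory.LocalRing.ResidueField.Basic
import HarnessLib

/-!
# The `u`-resultant of the Chow form of a prime with a form, II: valuations and integrality (towards LNM 1752 Ch. 3 Prop. 4.11, route B)

`Literature/NumberTheory/Transcendental/NesterenkoUResultantIntegral.lean`. Sequel of
`NesterenkoUResultant.lean` (the `u`-resultant `res = c^d ∏ Q₀(β⁽ⁱ⁾) ∈ Ω = ℚ(u₁, …, u_s)‾` of a
homogeneous prime `𝔭` of dimension `s` with an integer form `Q₀`, where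
`F_Ω = c ∏_{i<D} (β⁽ⁱ⁾ · u_{s+1})` is the splitting of the associated form over the generic linear
section, and `res ∈ K' = ℚ(u₁, …, u_s)` by Galois descent). Here we prove that `res` is a
POLYNOMIAL: `res ∈ A = ℚ[u₁, …, u_s]` (`uResultant`, `algebraMap_uResultant`). The argument is
valuation-theoretic and is the engine of the whole specialisation route (it is reused for the
integrality of the coefficients, for the degree bound and for specialisations in the sequels):

* `exists_integral_split` — **normalisation in a valuation ring**: if a non-zero form
  `Φ = c ∏ (β⁽ⁱ⁾ · u) ∈ K[u₀, …, u_m]` has all its coefficients in a valuation subring `V ⊆ K`,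
  then after rescaling the `β⁽ⁱ⁾` to PRIMITIVE vectors of `V^{m+1}` (some coordinate `= 1`) the
  constant `c` lies in `V` too: the product of the primitive linear forms is primitive (its
  reduction modulo the maximal ideal is a non-zero product in `k_V[u]`), so one of its coefficients
  is a unit of `V`. Consequently `c^d ∏ Q₀(β⁽ⁱ⁾) ∈ V` (`splitNorm_mem_valuationSubring`).
* `uResΩ_mem_valuationSubring` — hence `res ∈ V` for every valuation subring `V` of `Ω` containing
  the image of `A` (the coefficients of `F_Ω` lie in that image);
* `isIntegral_uResΩ` — so `res` is integral over `A` (an element outside the integral closure is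
  outside some valuation ring containing it, `Subring.exists_le_valuationSubring_of_isIntegrallyClosedIn`,
  Stacks 090P), and being in `K' = Frac A` with `A` integrally closed (a UFD) it lies in `A`:
  `uResultant 𝔭 s d Q₀ ∈ ℚ[u₁, …, u_s]` with `algebraMap (uResultant) = res`.

Definitions: `uResultant` (plumbing, with body); no named facts.

## References

* [NesterenkoPhilippon2001] Yu. V. Nesterenko, P. Philippon (eds.), *Introduction to Algebraic
  Independence Theory*, LNM 1752, Springer 2001, Ch. 3 §4, Prop. 4.11 (pp. 40–41).
* [Nes10] Yu. V. Nesterenko, Proc. Steklov Inst. Math. 218 (1997) 294–331, Prop. 1.4 (the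
  resultant is a polynomial in `u₁, …, u_{r−1}` with bounded denominators).
* O. Zariski, P. Samuel, *Commutative Algebra* II, Ch. VI §4 (integral closure = intersection of
  valuation rings).
-/

noncomputable section

open MvPolynomial

attribute [local instance] MvPolynomial.gradedAlgebra

namespace Literature.NumberTheory.Transcendental

namespace Nesterenko

variable {m : ℕ}

/-! ### Normalising a splitting inside a valuation ring -/

section Valuation

variable {K : Type*} [Field K] (V : ValuationSubring K)

/-- In a valued field, a non-zero vector has a coordinate dividing all the others in the
valuation ring. [folklore] -/
theorem exists_div_mem_valuationSubring {x : Fin (m + 1) → K} (hx : x ≠ 0) :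
    ∃ j₀, x j₀ ≠ 0 ∧ ∀ j, x j / x j₀ ∈ V := by
  obtain ⟨j₀, -, hmax⟩ := Finset.exists_max_image Finset.univ (fun j => V.valuation (x j))
    Finset.univ_nonempty
  have hj₀ : x j₀ ≠ 0 := by
    intro h0
    apply hx
    funext j
    have h := hmax j (Finset.mem_univ j)
    rw [h0, map_zero, le_zero_iff, map_eq_zero] at h
    exact h
  refine ⟨j₀, hj₀, fun j => ?_⟩
  rw [← V.valuation_le_one_iff, map_div₀]
  exact div_le_one_of_le₀ (hmax j (Finset.mem_univ j)) zero_le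

/-- A polynomial over the residue field of `V` which is a product of linear forms each having a
coefficient `1` is non-zero. [folklore] -/
theorem prod_lin_residue_ne_zero {D : ℕ} (β : Fin D → Fin (m + 1) → V)
    (hβ : ∀ i, ∃ j, β i j = 1) :
    (∏ i, (∑ j, C (IsLocalRing.residue V (β i j)) * X j) :
      MvPolynomial (Fin (m + 1)) (IsLocalRing.ResidueField V)) ≠ 0 := by
  refine Finset.prod_ne_zero_iff.mpr fun i _ => linK_ne_zero ?_
  obtain ⟨j, hj⟩ := hβ i
  intro h
  have := congrFun h j
  rw [hj, map_one, Pi.zero_apply] at this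
  exact one_ne_zero this

/-- **Normalisation of a splitting in a valuation ring.** Let `V ⊆ K` be a valuation subring and
`Φ = c ∏_{i<D} (β⁽ⁱ⁾ · u) ∈ K[u₀, …, u_m]` with `c ≠ 0`, all `β⁽ⁱ⁾ ≠ 0`, and all coefficients of
`Φ` in `V`. Then `Φ = c₁ ∏ (β₁⁽ⁱ⁾ · u)` with `c₁ ∈ V ∖ 0`, all `β₁⁽ⁱ⁾ ∈ V^{m+1}` non-zero multiples of the `β⁽ⁱ⁾` and each
`β₁⁽ⁱ⁾` having a coordinate equal to `1`; moreover `c^d ∏ Q₀(β⁽ⁱ⁾) = c₁^d ∏ Q₀(β₁⁽ⁱ⁾)` for every integer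
form `Q₀` of degree `d`. [folklore] -/
theorem exists_integral_split {Φ : MvPolynomial (Fin (m + 1)) K} {c : K} {D : ℕ}
    {β : Fin D → Fin (m + 1) → K} (hc : c ≠ 0) (hβ : ∀ i, β i ≠ 0)
    (hΦ : Φ = C c * ∏ i, (∑ j, C (β i j) * X j)) (hcoeff : ∀ e, coeff e Φ ∈ V)
    {d : ℕ} {Q₀ : MvPolynomial (Fin (m + 1)) ℤ} (hQ : Q₀.IsHomogeneous d) :
    ∃ (c₁ : V) (β₁ : Fin D → Fin (m + 1) → V), c₁ ≠ 0 ∧ (∀ i, ∃ j, β₁ i j = 1) ∧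
      (∀ i, ∃ a : K, a ≠ 0 ∧ (fun j => (β₁ i j : K)) = a • β i) ∧
      Φ = C (c₁ : K) * ∏ i, (∑ j, C (β₁ i j : K) * X j) ∧
      splitNorm d Q₀ c β = ((c₁ ^ d * ∏ i, aeval (β₁ i) Q₀ : V) : K) := by
  classical
  -- rescale each `β i` by a coordinate of minimal valuation
  choose j₀ hj₀ hdiv using fun i => exists_div_mem_valuationSubring V (hβ i)
  set lam : Fin D → K := fun i => β i (j₀ i) with hlam
  have hlam0 : ∀ i, lam i ≠ 0 := fun i => hj₀ i
  let β₁ : Fin D → Fin (m + 1) → V := fun i j => ⟨β i j / lam i, hdiv i j⟩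
  set c₁ : K := c * ∏ i, lam i with hc₁
  have hc₁0 : c₁ ≠ 0 := mul_ne_zero hc (Finset.prod_ne_zero_iff.mpr fun i _ => hlam0 i)
  have hone : ∀ i, ∃ j, β₁ i j = 1 := fun i => ⟨j₀ i, Subtype.ext (div_self (hlam0 i))⟩
  have hβ₁0 : ∀ i, (fun j => (β₁ i j : K)) ≠ 0 := by
    intro i h
    obtain ⟨j, hj⟩ := hone i
    have := congrFun h j
    rw [hj] at this
    exact one_ne_zero this
  -- the new splitting
  have hlin : ∀ i, ((∑ j, C (β₁ i j : K) * X j) : MvPolynomial (Fin (m + 1)) K) =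
      C (lam i)⁻¹ * (∑ j, C (β i j) * X j) := fun i => by
    rw [← linK_smul]
    refine Finset.sum_congr rfl fun j _ => ?_
    simp [β₁, div_eq_inv_mul]
  have hsplit : Φ = C c₁ * ∏ i, (∑ j, C (β₁ i j : K) * X j) := by
    have hprod : (∏ i, (∑ j, C (β₁ i j : K) * X j) : MvPolynomial (Fin (m + 1)) K) =
        C (∏ i, (lam i)⁻¹) * ∏ i, (∑ j, C (β i j) * X j) := by
      rw [map_prod C, ← Finset.prod_mul_distrib]
      exact Finset.prod_congr rfl fun i _ => hlin i
    have hcc : c₁ * ∏ i, (lam i)⁻¹ = c := by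
      rw [hc₁, mul_assoc, ← Finset.prod_mul_distrib,
        Finset.prod_eq_one (fun i _ => mul_inv_cancel₀ (hlam0 i)), mul_one]
    rw [hprod, ← mul_assoc, ← map_mul, hcc]
    exact hΦ
  -- the product of the primitive linear forms, over `V`
  set Pi₁ : MvPolynomial (Fin (m + 1)) V := ∏ i, (∑ j, C (β₁ i j) * X j) with hPi₁
  have hPimap : MvPolynomial.map V.subtype Pi₁ = ∏ i, (∑ j, C (β₁ i j : K) * X j) := by
    simp [hPi₁, map_prod, map_sum]
  -- `Pi₁` is primitive: some coefficient is a unit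
  have hPires : MvPolynomial.map (IsLocalRing.residue V) Pi₁ ≠ 0 := by
    have : MvPolynomial.map (IsLocalRing.residue V) Pi₁ =
        ∏ i, (∑ j, C (IsLocalRing.residue V (β₁ i j)) * X j) := by
      simp [hPi₁, map_prod, map_sum]
    rw [this]
    exact prod_lin_residue_ne_zero V β₁ hone
  obtain ⟨e, he⟩ := exists_coeff_ne_zero hPires
  rw [coeff_map, Ne, IsLocalRing.residue_eq_zero_iff] at he
  have hunit : IsUnit (coeff e Pi₁) :=
    of_not_not fun h => he ((IsLocalRing.mem_maximalIdeal _).mpr h)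
  -- hence `c₁ ∈ V`
  have hce : coeff e Φ = c₁ * ((coeff e Pi₁ : V) : K) := by
    rw [hsplit, ← hPimap, coeff_C_mul, coeff_map]
    rfl
  have hc₁V : c₁ ∈ V := by
    rw [← V.valuation_le_one_iff]
    have hπ : V.valuation ((coeff e Pi₁ : V) : K) = 1 := (V.valuation_eq_one_iff _).mp hunit
    have h1 : V.valuation (coeff e Φ) ≤ 1 := (V.valuation_le_one_iff _).mpr (hcoeff e)
    rw [hce, map_mul, hπ, mul_one] at h1
    exact h1
  have hprop : ∀ i, ∃ a : K, a ≠ 0 ∧ (fun j => (β₁ i j : K)) = a • β i := fun i =>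
    ⟨(lam i)⁻¹, inv_ne_zero (hlam0 i), funext fun j => by simp [β₁, div_eq_inv_mul]⟩
  refine ⟨⟨c₁, hc₁V⟩, β₁, fun h => hc₁0 (congrArg Subtype.val h), hone, hprop, hsplit, ?_⟩
  -- the split norm
  rw [splitNorm_eq_of_eq hQ hβ hβ₁0 hc (hΦ.symm.trans hsplit), splitNorm_def]
  change _ = V.subtype (⟨c₁, hc₁V⟩ ^ d * ∏ i, aeval (β₁ i) Q₀)
  rw [map_mul, map_pow, map_prod]
  congr 1
  refine Finset.prod_congr rfl fun i _ => ?_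
  rw [map_aeval_int]
  rfl

/-- In particular `c^d ∏ Q₀(β⁽ⁱ⁾) ∈ V`. [folklore] -/
theorem splitNorm_mem_valuationSubring {Φ : MvPolynomial (Fin (m + 1)) K} {c : K} {D : ℕ}
    {β : Fin D → Fin (m + 1) → K} (hc : c ≠ 0) (hβ : ∀ i, β i ≠ 0)
    (hΦ : Φ = C c * ∏ i, (∑ j, C (β i j) * X j)) (hcoeff : ∀ e, coeff e Φ ∈ V)
    {d : ℕ} {Q₀ : MvPolynomial (Fin (m + 1)) ℤ} (hQ : Q₀.IsHomogeneous d) :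
    splitNorm d Q₀ c β ∈ V := by
  obtain ⟨c₁, β₁, -, -, -, -, h⟩ := exists_integral_split V hc hβ hΦ hcoeff hQ
  rw [h]
  exact SetLike.coe_mem _

end Valuation

/-! ### The `u`-resultant is integral over `A = ℚ[u₁, …, u_s]`, hence a polynomial -/

section Prime

variable {s : ℕ} {𝔭 : Ideal (Rx m)}

/-- The coefficients of `F_Ω` lie in the image of `A`. [folklore] -/
theorem coeff_chowFormΩ_mem_range (𝔭 : Ideal (Rx m)) (s : ℕ) (e : Fin (m + 1) →₀ ℕ) :
    coeff e (chowFormΩ 𝔭 s) ∈ Set.range (algebraMap (RU s m) (ΩU s m)) := by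
  rw [chowFormΩ, coeff_map]
  exact ⟨_, rfl⟩

/-- **`res ∈ V` for every valuation subring `V ⊇ A` of `Ω`.** [folklore] -/
theorem uResΩ_mem_valuationSubring (h𝔭 : 𝔭.IsPrime)
    (hhom : 𝔭.IsHomogeneous (homogeneousSubmodule (Fin (m + 1)) ℚ))
    (hdim : ringKrullDim (Rx m ⧸ 𝔭) = (s + 1 : ℕ)) {d : ℕ} {Q₀ : MvPolynomial (Fin (m + 1)) ℤ}
    (hQ : Q₀.IsHomogeneous d) (V : ValuationSubring (ΩU s m))
    (hV : ∀ a : RU s m, algebraMap (RU s m) (ΩU s m) a ∈ V) : uResΩ 𝔭 s d Q₀ ∈ V := by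
  obtain ⟨hc, hβ, hF⟩ := splitConst_spec h𝔭 hhom hdim
  refine splitNorm_mem_valuationSubring V hc (fun i => (hβ i).1) hF (fun e => ?_) hQ
  obtain ⟨a, ha⟩ := coeff_chowFormΩ_mem_range 𝔭 s e
  rw [← ha]
  exact hV a

/-- **The `u`-resultant is integral over `A`** (integral closure = intersection of the valuation
rings containing `A`, Stacks 090P). [folklore] -/
theorem isIntegral_uResΩ (h𝔭 : 𝔭.IsPrime)
    (hhom : 𝔭.IsHomogeneous (homogeneousSubmodule (Fin (m + 1)) ℚ))
    (hdim : ringKrullDim (Rx m ⧸ 𝔭) = (s + 1 : ℕ)) {d : ℕ} {Q₀ : MvPolynomial (Fin (m + 1)) ℤ}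
    (hQ : Q₀.IsHomogeneous d) : IsIntegral (RU s m) (uResΩ 𝔭 s d Q₀) := by
  by_contra hni
  have hx : uResΩ 𝔭 s d Q₀ ∉ (integralClosure (RU s m) (ΩU s m)).toSubring := hni
  obtain ⟨V, hle, hV⟩ := Subring.exists_le_valuationSubring_of_isIntegrallyClosedIn hx
  exact hV (uResΩ_mem_valuationSubring h𝔭 hhom hdim hQ V fun a => hle isIntegral_algebraMap)

/-- Hence `res = algebraMap G` for a unique `G ∈ A = ℚ[u₁, …, u_s]` (`A` is integrally closed,
being a UFD, and `res ∈ K' = Frac A`). [folklore] -/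
theorem existsUnique_algebraMap_eq_uResΩ (h𝔭 : 𝔭.IsPrime)
    (hhom : 𝔭.IsHomogeneous (homogeneousSubmodule (Fin (m + 1)) ℚ))
    (hdim : ringKrullDim (Rx m ⧸ 𝔭) = (s + 1 : ℕ)) {d : ℕ} {Q₀ : MvPolynomial (Fin (m + 1)) ℤ}
    (hQ : Q₀.IsHomogeneous d) :
    ∃! G : RU s m, algebraMap (RU s m) (ΩU s m) G = uResΩ 𝔭 s d Q₀ := by
  obtain ⟨g, hg⟩ := uResΩ_mem_range_algebraMap h𝔭 hhom hdim hQ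
  have hint : IsIntegral (RU s m) g := by
    have h := isIntegral_uResΩ h𝔭 hhom hdim hQ
    rw [← hg] at h
    exact (isIntegral_algHom_iff (IsScalarTower.toAlgHom (RU s m) (KU s m) (ΩU s m))
      (algebraMap (KU s m) (ΩU s m)).injective).mp h
  haveI : IsIntegrallyClosed (RU s m) := UniqueFactorizationMonoid.instIsIntegrallyClosed
  obtain ⟨G, hG⟩ := IsIntegrallyClosed.isIntegral_iff.mp hint
  have hG' : algebraMap (RU s m) (ΩU s m) G = uResΩ 𝔭 s d Q₀ := by
    rw [IsScalarTower.algebraMap_apply (RU s m) (KU s m) (ΩU s m), hG, hg]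
  exact ⟨G, hG', fun G' hG'' => algebraMap_ΩU_injective s m (hG''.trans hG'.symm)⟩

/-- **The `u`-resultant of `𝔭` (a homogeneous prime of dimension `s`) with an integer form `Q₀` of
degree `d`**: the polynomial `G ∈ ℚ[u₁, …, u_s]` whose image in `Ω` is `c^d ∏ Q₀(β⁽ⁱ⁾)`
(junk `0` if `𝔭` is not such a prime). [cite: NesterenkoPhilippon2001, Ch. 3 Prop. 4.11
(pp. 40–41)] -/
def uResultant (𝔭 : Ideal (Rx m)) (s d : ℕ) (Q₀ : MvPolynomial (Fin (m + 1)) ℤ) : RU s m :=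
  open Classical in
  if h : ∃ G : RU s m, algebraMap (RU s m) (ΩU s m) G = uResΩ 𝔭 s d Q₀ then h.choose else 0

/-- `algebraMap (uResultant) = res`. [folklore] -/
theorem algebraMap_uResultant (h𝔭 : 𝔭.IsPrime)
    (hhom : 𝔭.IsHomogeneous (homogeneousSubmodule (Fin (m + 1)) ℚ))
    (hdim : ringKrullDim (Rx m ⧸ 𝔭) = (s + 1 : ℕ)) {d : ℕ} {Q₀ : MvPolynomial (Fin (m + 1)) ℤ}
    (hQ : Q₀.IsHomogeneous d) :
    algebraMap (RU s m) (ΩU s m) (uResultant 𝔭 s d Q₀) = uResΩ 𝔭 s d Q₀ := by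
  classical
  have h := (existsUnique_algebraMap_eq_uResΩ h𝔭 hhom hdim hQ).exists
  rw [uResultant, dif_pos h]
  exact h.choose_spec

/-- **Integrality of the `u`-resultant at a valuation**: for every valuation subring `V` of `Ω`
containing the image of `A`, `uResultant ∈ V` (as an element of `Ω`). [folklore] -/
theorem algebraMap_uResultant_mem (h𝔭 : 𝔭.IsPrime)
    (hhom : 𝔭.IsHomogeneous (homogeneousSubmodule (Fin (m + 1)) ℚ))
    (hdim : ringKrullDim (Rx m ⧸ 𝔭) = (s + 1 : ℕ)) {d : ℕ} {Q₀ : MvPolynomial (Fin (m + 1)) ℤ}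
    (hQ : Q₀.IsHomogeneous d) (V : ValuationSubring (ΩU s m))
    (hV : ∀ a : RU s m, algebraMap (RU s m) (ΩU s m) a ∈ V) :
    algebraMap (RU s m) (ΩU s m) (uResultant 𝔭 s d Q₀) ∈ V := by
  rw [algebraMap_uResultant h𝔭 hhom hdim hQ]
  exact uResΩ_mem_valuationSubring h𝔭 hhom hdim hQ V hV

end Prime


end Nesterenko

end Literature.NumberTheory.Transcendental

end
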